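import Literature.RepresentationTheory.HeisenbergGroup.ImplementerOmega
import HarnessLib

/-!
# Eigenvectors of `ω = β⁻¹ · (r ∘ ι)` on a compact subgroup: the big-cell argument for the unramified vector

[cite: GelbartRogawski1991, §3.1 (3.1.3) p. 456; MoeglinVignerasWaldspurger1987, Chap. 2 II.10; HoweUnramified1979, Thm 7.1]

For the genuine representation `ω(g) = β(g)⁻¹ r(ι g)` of `H` (`ImplementerOmega`) and a vector `f ≠ 0` which is an
EIGENVECTOR of `ω(w)` and of `ω(k)` (as happens for the unramified vector `1_{𝒪^N}` under every element of a
hyperspecial compact subgroup `K`, MVW Chap. 2 II.10), the eigenvalue of `ω(k)` is `1` as soon as `k` can be moved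
into the big cell by an element `w n'` with `n'`, and the big-cell factors `p`, `n` of `w n' k = p w n`, all FIXING
`f` (`omega_apply_eq_self_of_bigCell_relation`): `s_k s_w f = ω(w n' k) f = ω(p w n) f = s_w f`. This is the
group-theoretic skeleton of the unramified clause "`K` fixes `1_{𝒪^N}` through `ω`" of [GelbartRogawski1991, (3.1.3)]:
no generation statement for `K` and no value of `β` at `w` is needed.
-/

set_option autoImplicit false

noncomputable section

namespace Literature.RepresentationTheory.HeisenbergGroup

namespace ImplementerSection

universe u v u' v'

variable {R : Type u} [CommRing R] [Invertible (2 : R)] {V : Type v} [AddCommGroup V] [Module R V]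
  {B : V →ₗ[R] V →ₗ[R] R}
variable {k : Type u'} [Field k] {S : Type v'} [AddCommGroup S] [Module k S] [Nontrivial S]
variable {ρ : Representation k (Heisenberg B) S} (r : ImplementerSection ρ) (hU : ImplementerUniqueUpToScalar ρ)
variable {H : Type*} [Group H] (ι : H →* symplecticGroup B) {β : H → kˣ}
variable (hβ : ∀ g₁ g₂ : H, β (g₁ * g₂) * r.cocycle hU (ι g₁) (ι g₂) = β g₁ * β g₂)

omit [Nontrivial S] in
/-- `ω(g)` is `k`-linear: `ω(g)(s • f) = s • ω(g) f`. [cite: MoeglinVignerasWaldspurger1987, Chap. 2 II.1] -/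
theorem omega_smul (g : H) (s : k) (f : S) : r.omega ι β g (s • f) = s • r.omega ι β g f := by
  rw [omega_apply, omega_apply, map_smul, smul_comm]

include hβ in
/-- **the big-cell argument**: if `f ≠ 0` is an eigenvector of `ω(w)` and of `ω(k)`, and `w n' k = p (w n)` with
`ω(n') f = ω(p) f = ω(n) f = f`, then `ω(k) f = f`. [cite: GelbartRogawski1991, §3.1 (3.1.3) p. 456;
MoeglinVignerasWaldspurger1987, Chap. 2 II.10] -/
theorem omega_apply_eq_self_of_bigCell_relation {f : S} (hf : f ≠ 0) {w g n' p n : H}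
    (hw : ∃ s : k, r.omega ι β w f = s • f) (hg : ∃ s : k, r.omega ι β g f = s • f)
    (hn' : r.omega ι β n' f = f) (hp : r.omega ι β p f = f) (hn : r.omega ι β n f = f)
    (hrel : w * n' * g = p * (w * n)) : r.omega ι β g f = f := by
  obtain ⟨sw, hsw⟩ := hw
  obtain ⟨sg, hsg⟩ := hg
  have h1 : r.omega ι β (w * n' * g) f = (sg * sw) • f := by
    rw [r.omega_mul hU ι hβ, r.omega_mul hU ι hβ, hsg, r.omega_smul, hn', r.omega_smul, hsw, smul_smul]
  have h2 : r.omega ι β (p * (w * n)) f = sw • f := by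
    rw [r.omega_mul hU ι hβ, r.omega_mul hU ι hβ, hn, hsw, r.omega_smul, hp]
  rw [hrel, h2] at h1
  have h3 : (sg * sw - sw) • f = 0 := by rw [sub_smul, ← h1, sub_self]
  have hsw0 : sw ≠ 0 := by
    rintro rfl
    rw [zero_smul] at hsw
    exact hf (by
      have := r.omega_inv_apply hU ι hβ w f
      rw [hsw, omega_apply, map_zero, smul_zero] at this
      exact this.symm)
  have hsg1 : sg = 1 := by
    rcases smul_eq_zero.1 h3 with h | h
    · have : (sg - 1) * sw = 0 := by rw [sub_mul, one_mul]; exact h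
      exact sub_eq_zero.1 ((mul_eq_zero.1 this).resolve_right hsw0)
    · exact absurd h hf
  rw [hsg, hsg1, one_smul]

include hβ in
/-- **corollary (the shape of the unramified clause)**: on a subgroup `K` on which `f ≠ 0` is a common eigenvector
of `ω`, containing `w`, such that every `g ∈ K` satisfies a big-cell relation `w n' g = p (w n)` with `n', p, n` in
the subset of `K` fixing `f`, the whole of `K` fixes `f`. [cite: GelbartRogawski1991, §3.1 (3.1.3) p. 456;
MoeglinVignerasWaldspurger1987, Chap. 2 II.10] -/
theorem omega_apply_eq_self_of_forall_bigCell_relation {f : S} (hf : f ≠ 0) (K : Subgroup H)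
    (heig : ∀ g ∈ K, ∃ s : k, r.omega ι β g f = s • f) {w : H} (hwK : w ∈ K)
    (hcell : ∀ g ∈ K, ∃ n' p n : H, r.omega ι β n' f = f ∧ r.omega ι β p f = f ∧ r.omega ι β n f = f ∧
      w * n' * g = p * (w * n)) :
    ∀ g ∈ K, r.omega ι β g f = f := by
  intro g hg
  obtain ⟨n', p, n, hn', hp, hn, hrel⟩ := hcell g hg
  exact r.omega_apply_eq_self_of_bigCell_relation hU ι hβ hf (heig w hwK) (heig g hg) hn' hp hn hrel

include hβ in
/-- `ω(w⁻¹) f = s⁻¹ • f` if `ω(w) f = s • f` (`f ≠ 0` forces `s ≠ 0`). [cite: MoeglinVignerasWaldspurger1987, Chap. 2 II.10] -/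
theorem omega_inv_apply_of_eigen {f : S} (hf : f ≠ 0) {w : H} {s : k} (hw : r.omega ι β w f = s • f) :
    s ≠ 0 ∧ r.omega ι β w⁻¹ f = s⁻¹ • f := by
  have h := r.omega_inv_apply hU ι hβ w f
  rw [hw, r.omega_smul] at h
  have hs : s ≠ 0 := by
    rintro rfl
    rw [zero_smul] at h
    exact hf h.symm
  refine ⟨hs, ?_⟩
  have := congrArg (fun x => s⁻¹ • x) h
  simp only [smul_smul, inv_mul_cancel₀ hs, one_smul] at this
  exact this

include hβ in
/-- **the big-cell argument, sharpened**: ONLY the eigenvector property of `ω(w)` is needed — if `ω(w) f = s f`,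
`w n' g = p (w n)` and `n', p, n` fix `f`, then `ω(g) f = f` (`g = n'⁻¹ w⁻¹ p w n`, `ω(w)⁻¹ f = s⁻¹ f`). This is
the form used for the unramified vector: no eigenvector property of `ω(g)` and no generation of the compact group.
[cite: GelbartRogawski1991, §3.1 (3.1.3) p. 456; MoeglinVignerasWaldspurger1987, Chap. 2 II.10] -/
theorem omega_apply_eq_self_of_bigCell_relation' {f : S} (hf : f ≠ 0) {w g n' p n : H}
    (hw : ∃ s : k, r.omega ι β w f = s • f)
    (hn' : r.omega ι β n' f = f) (hp : r.omega ι β p f = f) (hn : r.omega ι β n f = f)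
    (hrel : w * n' * g = p * (w * n)) : r.omega ι β g f = f := by
  obtain ⟨s, hs⟩ := hw
  obtain ⟨-, hwinv⟩ := r.omega_inv_apply_of_eigen hU ι hβ hf hs
  have hg : g = n'⁻¹ * (w⁻¹ * (p * (w * n))) := by
    rw [← hrel]; group
  have hn'inv : r.omega ι β n'⁻¹ f = f := by
    conv_lhs => rw [← hn']
    exact r.omega_inv_apply hU ι hβ n' f
  rw [hg, r.omega_mul hU ι hβ, r.omega_mul hU ι hβ, r.omega_mul hU ι hβ, r.omega_mul hU ι hβ, hn, hs, r.omega_smul, hp,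
    r.omega_smul, hwinv, smul_smul, mul_inv_cancel₀ (r.omega_inv_apply_of_eigen hU ι hβ hf hs).1, one_smul, hn'inv]

include hβ in
/-- **corollary for a subgroup `K ∋ w`** (the shape of the unramified clause): if `f ≠ 0` is an eigenvector of `ω(w)`
and every `g ∈ K` satisfies a big-cell relation `w n' g = p (w n)` with `n', p, n` fixing `f`, then all of `K` fixes
`f`. [cite: GelbartRogawski1991, §3.1 (3.1.3) p. 456; MoeglinVignerasWaldspurger1987, Chap. 2 II.10] -/
theorem omega_apply_eq_self_of_forall_bigCell_relation' {f : S} (hf : f ≠ 0) (K : Set H) {w : H}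
    (hw : ∃ s : k, r.omega ι β w f = s • f)
    (hcell : ∀ g ∈ K, ∃ n' p n : H, r.omega ι β n' f = f ∧ r.omega ι β p f = f ∧ r.omega ι β n f = f ∧
      w * n' * g = p * (w * n)) :
    ∀ g ∈ K, r.omega ι β g f = f := by
  intro g hg
  obtain ⟨n', p, n, hn', hp, hn, hrel⟩ := hcell g hg
  exact r.omega_apply_eq_self_of_bigCell_relation' hU ι hβ hf hw hn' hp hn hrel

end ImplementerSection

end Literature.RepresentationTheory.HeisenbergGroup

end
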